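import Summits.QuantumFields.YangMills.Theorems.LuscherReductionTwistedTraceScalingBTDiagonalKinetic
import Summits.QuantumFields.YangMills.Theorems.LuscherReductionTwistedTraceScalingBTDiagonalMagnetic
import Summits.QuantumFields.YangMills.Theorems.LuscherReductionTwistedTraceScalingBTTubeMagnetic
import Literature.MathematicalPhysics.QuantumFieldTheory.WilsonEnergyConvexity
import HarnessLib

/-!
# The DIAGONAL Laplace exponent `X_u(z)` of `fpBOKernel(u,u)/K₁(u,u)` relative to `u = 1`: EXACT split `X = X⁽¹⁾ + X⁽²⁾`, `X⁽¹⁾` linear in `slowLin u`, explicit bounds, zero colour average of `X⁽¹⁾`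
# (lane A of S-BASE, crux `TwistedTraceScaling` stmt-QuantumFields-20203, C4-CORE, the (B-T) pen (C″); design note `pub/ym-fleet/ym-luscher-20007-p1/COARSE-DESIGN.md` §25.7 (L3))

Assembly of the pointwise algebra of (L3).  With `z = (v, v', g)` (fibre fluctuations on the cap, gauge fluctuation) the integrand of `f(u) = fpBOKernel(u,u)/K₁(u,u)` is the `u = 1` integrand times
`exp(diagX β u v v' g)` where (`S₁(1) = 0`, `TC₁(u,u) = 6`)
`diagX = β[TC(oT u v, g·oT u v') − TC(oT 1 v, g·oT 1 v')] − (β/2)[(S(oT u v) − L³S₁(u)) − S(oT 1 v)] − (β/2)[(S(oT u v') − L³S₁(u)) − S(oT 1 v')]`.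
* `diagX`, `diagX1` (the part LINEAR in `c = slowLin u`: `β·(−2Σ_e c_k·(g⃗_y × M⃗_e)) − β(⟪D_1v̂, D'(c)v̂⟫ + ⟪D_1v̂', D'(c)v̂'⟫)`, `v̂ = linkEmbed v`);
* ★★ `abs_diagX_sub_diagX1_le` — `|diagX − diagX1| ≤ β·[48Σ_e‖u⃗_k‖²‖g⃗_y‖‖M⃗_e‖ + ½Σ_{w=v̂,v̂'}((σ/2)‖D_uw‖² + E(τ,σ) + E(τ,0) + 1.45·10⁸Nτ_u²‖w‖²)]`
  (`timeCoupling_orthoTube_gauge_diag_sub` + `abs_wilsonAction_orthoTube_sub_le` at `u` and at `1` + `abs_stiffForm_sub_le`);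
* ★ `abs_diagX1_le` — `|diagX1| ≤ β·[12Σ_e‖c_k‖‖g⃗_y‖‖M⃗_e‖ + 80Nτ_u(‖v̂‖² + ‖v̂'‖²)]` (`norm_covCurl_le_op`, `norm_covCurlLin_le`, Cauchy–Schwarz);
* ★★ `diagX1_conj` / `integral_diagX1_conj_eq_zero` — `diagX1 β (dud⁻¹) = [c ↦ Ad(d)c]` and `∫_d diagX1 β (dud⁻¹) v v' g dd = 0`.
On the core (`‖v‖,‖v'‖,‖g⃗‖ ≲ β^{-1/2}log β`, `‖u⃗‖ ≲ δ = β^{-s}`, `σ = O(L³δ⁴)`) these are `ε₁ = O(δlog²β)`, `ε₂ = O(δ²log²β + β^{-1/2}log³β)` of §25.7; the Haar sandwich of `…BTColourAveraging` then gives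
`∫_d e^{diagX(dud⁻¹)} dd ∈ [1 − ε₂, 1 + ε₂ + (ε₁+ε₂)²]` pointwise in `z` (successor: `…BTDiagonalAverage`, measurability in `d` + the sandwich).
HONEST FRAMING: bookkeeping of landed exact identities for a stub of a child of the CONDITIONAL reduction route R2b1; the Laplace core of (B-T) is OPEN; C4-CORE OPEN; not infinite volume,
not a gap, not Clay.
-/

set_option autoImplicit false

noncomputable section

open MeasureTheory Filter Topology Real
open scoped BigOperators Matrix InnerProductSpace RealInnerProductSpace
open Literature.MathematicalPhysics.QuantumFieldTheory
open Literature.MathematicalPhysics.QuantumLattice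

namespace Summit.QuantumFields.YangMills.Theorems.FemtoTransferGap.TwoLattice.ConstTube

open Summit.QuantumFields.YangMills.Theorems.FemtoTransferGap
open Summit.QuantumFields.YangMills.Theorems.FemtoTransferGap.TwoLattice
open Summit.QuantumFields.YangMills.Theorems.FemtoTransferGap.TwoLattice.Stiff
open Summit.QuantumFields.YangMills.Theorems.FemtoTransferGap.TwoLattice.Cov
open Summit.QuantumFields.YangMills.Theorems.FemtoTransferGap.TwoLattice.Toron

variable (L : ℕ) [NeZero L]

/-! ## §1 The diagonal exponent and its linear part -/

/-- **The diagonal Laplace exponent** relative to `u = 1` (see the module docstring). [cite: Luscher1983, §3] -/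
def diagX (β : ℝ) (u : GaugeConfig 3 1 SU2) (v v' : Edge 3 L → Fin 3 → ℝ) (g : Site 3 L → SU2) : ℝ :=
  β * (timeCoupling su2Rep (orthoTube L u v) (gaugeTransform g (orthoTube L u v')) - timeCoupling su2Rep (orthoTube L 1 v) (gaugeTransform g (orthoTube L 1 v'))) -
    β / 2 * ((wilsonAction su2Rep (orthoTube L u v) - (L : ℝ) ^ 3 * wilsonAction su2Rep u) - wilsonAction su2Rep (orthoTube L 1 v)) -
    β / 2 * ((wilsonAction su2Rep (orthoTube L u v') - (L : ℝ) ^ 3 * wilsonAction su2Rep u) - wilsonAction su2Rep (orthoTube L 1 v'))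

/-- The `u`-independent link quaternion `M_e = chart(v'_e)⁻¹ g_x⁻¹ chart(v_e)` of the diagonal kinetic term. [folklore] -/
def linkM (v v' : Edge 3 L → Fin 3 → ℝ) (g : Site 3 L → SU2) (e : Edge 3 L) : SU2 := (chartSU2 (v' e))⁻¹ * (g e.1)⁻¹ * chartSU2 (v e)

/-- **The LINEAR part** of the diagonal exponent, as a function of the colour vectors `c` (kinetic + magnetic). [cite: Luscher1983, §3] -/
def diagX1 (β : ℝ) (c : Fin 3 → Fin 3 → ℝ) (v v' : Edge 3 L → Fin 3 → ℝ) (g : Site 3 L → SU2) : ℝ :=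
  β * (-(2 * ∑ e : Edge 3 L, c e.2 ⬝ᵥ (vecPart (g (e.1.shift e.2)) ⨯₃ vecPart (linkM L v v' g e)))) -
    β / 2 * (2 * ⟪covCurl (1 : GaugeConfig 3 L SU2) (linkEmbed L v), covCurlLin c (linkEmbed L v)⟫) -
    β / 2 * (2 * ⟪covCurl (1 : GaugeConfig 3 L SU2) (linkEmbed L v'), covCurlLin c (linkEmbed L v')⟫)

variable {L}

/-! ## §2 ★★ The second-order remainder -/

/-- ★★ **`|diagX − diagX1(slowLin u)| ≤ β·(second-order terms)`** on the cap, for `|v_{e,c}|, |v'_{e,c}| ≤ τ ≤ 1/30`, `L³S₁(u) ≤ σ < 2`, `|u⃗_{k,a}| ≤ τ_u ≤ 1`, `β ≥ 0`.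
[cite: Luscher1983, §3] -/
theorem abs_diagX_sub_diagX1_le {β : ℝ} (hβ : 0 ≤ β) (u : GaugeConfig 3 1 SU2) {v v' : Edge 3 L → Fin 3 → ℝ} (hv : v ∈ capBalancedSet L) (hv' : v' ∈ capBalancedSet L)
    {τ σ τu : ℝ} (hτ : τ ≤ 1 / 30) (hσ : σ < 2) (hS : (L : ℝ) ^ 3 * wilsonAction su2Rep u ≤ σ) (hvτ : ∀ (e : Edge 3 L) (c : Fin 3), |v e c| ≤ τ)
    (hvτ' : ∀ (e : Edge 3 L) (c : Fin 3), |v' e c| ≤ τ) (hτu : τu ≤ 1) (hu : ∀ (k : Fin 3) (a : Fin 3), |vecPart (u (0, k)) a| ≤ τu) (g : Site 3 L → SU2) :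
    |diagX L β u v v' g - diagX1 L β (slowLin u) v v' g| ≤
      β * (48 * ∑ e : Edge 3 L, ‖vecPart (u (0, e.2))‖ ^ 2 * ‖vecPart (g (e.1.shift e.2))‖ * ‖vecPart (linkM L v v' g e)‖) +
      β / 2 * ((σ / 2 * ‖covCurl (constLift L u) (linkEmbed L v)‖ ^ 2 + stepActionErr (L := L) τ σ) + stepActionErr (L := L) τ 0 +
        145000000 * (Fintype.card (Plaquette 3 L × Fin 3) : ℝ) * τu ^ 2 * ‖linkEmbed L v‖ ^ 2) +
      β / 2 * ((σ / 2 * ‖covCurl (constLift L u) (linkEmbed L v')‖ ^ 2 + stepActionErr (L := L) τ σ) + stepActionErr (L := L) τ 0 +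
        145000000 * (Fintype.card (Plaquette 3 L × Fin 3) : ℝ) * τu ^ 2 * ‖linkEmbed L v'‖ ^ 2) := by
  -- kinetic
  have hkin := timeCoupling_orthoTube_gauge_diag_sub (L := L) u g v v'
  have hkin2 := abs_diagKinetic_second_le (L := L) (fun k => vecPart (u (0, k))) (fun e => vecPart (g (e.1.shift e.2))) (fun e => vecPart (linkM L v v' g e))
  -- magnetic, at `u` and at `1`
  have hS1 : (L : ℝ) ^ 3 * wilsonAction su2Rep (1 : GaugeConfig 3 1 SU2) ≤ 0 := by rw [wilsonAction_one_eq_zero]; simp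
  have hmu := abs_wilsonAction_orthoTube_sub_le (L := L) u hv hτ hσ hS hvτ
  have hmu' := abs_wilsonAction_orthoTube_sub_le (L := L) u hv' hτ hσ hS hvτ'
  have hm1 := abs_wilsonAction_orthoTube_sub_le (L := L) (1 : GaugeConfig 3 1 SU2) hv hτ (by norm_num : (0 : ℝ) < 2) hS1 hvτ
  have hm1' := abs_wilsonAction_orthoTube_sub_le (L := L) (1 : GaugeConfig 3 1 SU2) hv' hτ (by norm_num : (0 : ℝ) < 2) hS1 hvτ'
  rw [wilsonAction_one_eq_zero, mul_zero, sub_zero, constLift_one', zero_div, zero_mul, zero_add] at hm1 hm1'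
  -- the stiffness form at first order
  have hst := abs_stiffForm_sub_le (L := L) u hτu hu (linkEmbed L v)
  have hst' := abs_stiffForm_sub_le (L := L) u hτu hu (linkEmbed L v')
  -- algebra: the difference is β·(kinetic second-order) − (β/2)·(magnetic remainders)
  have hsplit : diagX L β u v v' g - diagX1 L β (slowLin u) v v' g =
      β * (-(4 * ∑ e : Edge 3 L, (vecPart (u (0, e.2)) ⨯₃ (vecPart (u (0, e.2)) ⨯₃ vecPart (g (e.1.shift e.2)))) ⬝ᵥ vecPart (linkM L v v' g e))) -
      β / 2 * ((wilsonAction su2Rep (orthoTube L u v) - (L : ℝ) ^ 3 * wilsonAction su2Rep u - ‖covCurl (constLift L u) (linkEmbed L v)‖ ^ 2) -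
        (wilsonAction su2Rep (orthoTube L 1 v) - ‖covCurl (1 : GaugeConfig 3 L SU2) (linkEmbed L v)‖ ^ 2) +
        (‖covCurl (constLift L u) (linkEmbed L v)‖ ^ 2 - ‖covCurl (1 : GaugeConfig 3 L SU2) (linkEmbed L v)‖ ^ 2 -
          2 * ⟪covCurl (1 : GaugeConfig 3 L SU2) (linkEmbed L v), covCurlLin (slowLin u) (linkEmbed L v)⟫)) -
      β / 2 * ((wilsonAction su2Rep (orthoTube L u v') - (L : ℝ) ^ 3 * wilsonAction su2Rep u - ‖covCurl (constLift L u) (linkEmbed L v')‖ ^ 2) -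
        (wilsonAction su2Rep (orthoTube L 1 v') - ‖covCurl (1 : GaugeConfig 3 L SU2) (linkEmbed L v')‖ ^ 2) +
        (‖covCurl (constLift L u) (linkEmbed L v')‖ ^ 2 - ‖covCurl (1 : GaugeConfig 3 L SU2) (linkEmbed L v')‖ ^ 2 -
          2 * ⟪covCurl (1 : GaugeConfig 3 L SU2) (linkEmbed L v'), covCurlLin (slowLin u) (linkEmbed L v')⟫)) := by
    unfold diagX diagX1
    rw [hkin]
    unfold linkM slowLin
    ring
  rw [hsplit]
  -- names for the pieces
  set K4 : ℝ := 4 * ∑ e : Edge 3 L, (vecPart (u (0, e.2)) ⨯₃ (vecPart (u (0, e.2)) ⨯₃ vecPart (g (e.1.shift e.2)))) ⬝ᵥ vecPart (linkM L v v' g e) with hK4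
  set mv : ℝ := wilsonAction su2Rep (orthoTube L u v) - (L : ℝ) ^ 3 * wilsonAction su2Rep u - ‖covCurl (constLift L u) (linkEmbed L v)‖ ^ 2 with hmv
  set nv : ℝ := wilsonAction su2Rep (orthoTube L 1 v) - ‖covCurl (1 : GaugeConfig 3 L SU2) (linkEmbed L v)‖ ^ 2 with hnv
  set pv : ℝ := ‖covCurl (constLift L u) (linkEmbed L v)‖ ^ 2 - ‖covCurl (1 : GaugeConfig 3 L SU2) (linkEmbed L v)‖ ^ 2 -
    2 * ⟪covCurl (1 : GaugeConfig 3 L SU2) (linkEmbed L v), covCurlLin (slowLin u) (linkEmbed L v)⟫ with hpv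
  set mv' : ℝ := wilsonAction su2Rep (orthoTube L u v') - (L : ℝ) ^ 3 * wilsonAction su2Rep u - ‖covCurl (constLift L u) (linkEmbed L v')‖ ^ 2 with hmv'
  set nv' : ℝ := wilsonAction su2Rep (orthoTube L 1 v') - ‖covCurl (1 : GaugeConfig 3 L SU2) (linkEmbed L v')‖ ^ 2 with hnv'
  set pv' : ℝ := ‖covCurl (constLift L u) (linkEmbed L v')‖ ^ 2 - ‖covCurl (1 : GaugeConfig 3 L SU2) (linkEmbed L v')‖ ^ 2 -
    2 * ⟪covCurl (1 : GaugeConfig 3 L SU2) (linkEmbed L v'), covCurlLin (slowLin u) (linkEmbed L v')⟫ with hpv'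
  have hβ2 : 0 ≤ β / 2 := by linarith
  have hM : |mv - nv + pv| ≤ |mv| + |nv| + |pv| := by
    calc |mv - nv + pv| ≤ |mv - nv| + |pv| := abs_add_le _ _
      _ ≤ |mv| + |nv| + |pv| := by linarith [abs_sub mv nv]
  have hM' : |mv' - nv' + pv'| ≤ |mv'| + |nv'| + |pv'| := by
    calc |mv' - nv' + pv'| ≤ |mv' - nv'| + |pv'| := abs_add_le _ _
      _ ≤ |mv'| + |nv'| + |pv'| := by linarith [abs_sub mv' nv']
  have h1 : |β * -K4| ≤ β * (48 * ∑ e : Edge 3 L, ‖vecPart (u (0, e.2))‖ ^ 2 * ‖vecPart (g (e.1.shift e.2))‖ * ‖vecPart (linkM L v v' g e)‖) := by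
    rw [abs_mul, abs_neg, abs_of_nonneg hβ]; exact mul_le_mul_of_nonneg_left hkin2 hβ
  have h2 : |β / 2 * (mv - nv + pv)| ≤ β / 2 * (|mv| + |nv| + |pv|) := by
    rw [abs_mul, abs_of_nonneg hβ2]; exact mul_le_mul_of_nonneg_left hM hβ2
  have h3 : |β / 2 * (mv' - nv' + pv')| ≤ β / 2 * (|mv'| + |nv'| + |pv'|) := by
    rw [abs_mul, abs_of_nonneg hβ2]; exact mul_le_mul_of_nonneg_left hM' hβ2
  have htri : |β * -K4 - β / 2 * (mv - nv + pv) - β / 2 * (mv' - nv' + pv')| ≤ |β * -K4| + |β / 2 * (mv - nv + pv)| + |β / 2 * (mv' - nv' + pv')| := by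
    calc |β * -K4 - β / 2 * (mv - nv + pv) - β / 2 * (mv' - nv' + pv')| ≤ |β * -K4 - β / 2 * (mv - nv + pv)| + |β / 2 * (mv' - nv' + pv')| := abs_sub _ _
      _ ≤ |β * -K4| + |β / 2 * (mv - nv + pv)| + |β / 2 * (mv' - nv' + pv')| := by linarith [abs_sub (β * -K4) (β / 2 * (mv - nv + pv))]
  have hb2 := mul_le_mul_of_nonneg_left hmu hβ2
  have hb2' := mul_le_mul_of_nonneg_left hmu' hβ2
  have hc2 := mul_le_mul_of_nonneg_left hm1 hβ2
  have hc2' := mul_le_mul_of_nonneg_left hm1' hβ2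
  have hd2 := mul_le_mul_of_nonneg_left hst hβ2
  have hd2' := mul_le_mul_of_nonneg_left hst' hβ2
  linarith [htri, h1, h2, h3, hb2, hb2', hc2, hc2', hd2, hd2']

/-! ## §3 ★ The size of the linear part -/

/-- ★ **`|diagX1(c)| ≤ β·[12Σ_e‖c_k‖‖g⃗_y‖‖M⃗_e‖ + 40√N·√N·α(‖v̂‖² + ‖v̂'‖²)]`** for `|c_{k,a}| ≤ α`. [folklore] -/
theorem abs_diagX1_le {β : ℝ} (hβ : 0 ≤ β) {c : Fin 3 → Fin 3 → ℝ} {α : ℝ} (hc : ∀ k a, |c k a| ≤ α) (v v' : Edge 3 L → Fin 3 → ℝ) (g : Site 3 L → SU2) :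
    |diagX1 L β c v v' g| ≤ β * (12 * ∑ e : Edge 3 L, ‖c e.2‖ * ‖vecPart (g (e.1.shift e.2))‖ * ‖vecPart (linkM L v v' g e)‖) +
      β * (40 * α * (Fintype.card (Plaquette 3 L × Fin 3) : ℝ) * (‖linkEmbed L v‖ ^ 2 + ‖linkEmbed L v'‖ ^ 2)) := by
  set N : ℝ := (Fintype.card (Plaquette 3 L × Fin 3) : ℝ) with hN
  have hN0 : 0 ≤ N := by rw [hN]; positivity
  have hsq : Real.sqrt N * Real.sqrt N = N := Real.mul_self_sqrt hN0
  have hα : 0 ≤ α := (abs_nonneg _).trans (hc 0 0)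
  have hkin := abs_diagKinetic_linear_le (L := L) c (fun e => vecPart (g (e.1.shift e.2))) (fun e => vecPart (linkM L v v' g e))
  have hmag : ∀ w : LinkSpace L, |⟪covCurl (1 : GaugeConfig 3 L SU2) w, covCurlLin c w⟫| ≤ 40 * α * N * ‖w‖ ^ 2 := fun w => by
    have h1 := abs_real_inner_le_norm (covCurl (1 : GaugeConfig 3 L SU2) w) (covCurlLin c w)
    have h2 := norm_covCurl_le_op (1 : GaugeConfig 3 L SU2) w
    have h3 := norm_covCurlLin_le (L := L) hc w
    have h4 : ‖covCurl (1 : GaugeConfig 3 L SU2) w‖ * ‖covCurlLin c w‖ ≤ (10 * Real.sqrt N * ‖w‖) * (4 * α * Real.sqrt N * ‖w‖) :=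
      mul_le_mul h2 h3 (norm_nonneg _) (by positivity)
    calc |⟪covCurl (1 : GaugeConfig 3 L SU2) w, covCurlLin c w⟫| ≤ (10 * Real.sqrt N * ‖w‖) * (4 * α * Real.sqrt N * ‖w‖) := h1.trans h4
      _ = 40 * α * (Real.sqrt N * Real.sqrt N) * ‖w‖ ^ 2 := by ring
      _ = 40 * α * N * ‖w‖ ^ 2 := by rw [hsq]
  have hmv := hmag (linkEmbed L v)
  have hmv' := hmag (linkEmbed L v')
  unfold diagX1
  have e1 : β * -(2 * ∑ e : Edge 3 L, c e.2 ⬝ᵥ (vecPart (g (e.1.shift e.2)) ⨯₃ vecPart (linkM L v v' g e))) -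
      β / 2 * (2 * ⟪covCurl (1 : GaugeConfig 3 L SU2) (linkEmbed L v), covCurlLin c (linkEmbed L v)⟫) -
      β / 2 * (2 * ⟪covCurl (1 : GaugeConfig 3 L SU2) (linkEmbed L v'), covCurlLin c (linkEmbed L v')⟫) =
      -(β * ((2 * ∑ e : Edge 3 L, c e.2 ⬝ᵥ (vecPart (g (e.1.shift e.2)) ⨯₃ vecPart (linkM L v v' g e))) +
        ⟪covCurl (1 : GaugeConfig 3 L SU2) (linkEmbed L v), covCurlLin c (linkEmbed L v)⟫ + ⟪covCurl (1 : GaugeConfig 3 L SU2) (linkEmbed L v'), covCurlLin c (linkEmbed L v')⟫)) := by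
    ring
  rw [e1, abs_neg, abs_mul, abs_of_nonneg hβ, ← mul_add]
  refine mul_le_mul_of_nonneg_left ?_ hβ
  calc |(2 * ∑ e : Edge 3 L, c e.2 ⬝ᵥ (vecPart (g (e.1.shift e.2)) ⨯₃ vecPart (linkM L v v' g e))) +
        ⟪covCurl (1 : GaugeConfig 3 L SU2) (linkEmbed L v), covCurlLin c (linkEmbed L v)⟫ + ⟪covCurl (1 : GaugeConfig 3 L SU2) (linkEmbed L v'), covCurlLin c (linkEmbed L v')⟫|
      ≤ |2 * ∑ e : Edge 3 L, c e.2 ⬝ᵥ (vecPart (g (e.1.shift e.2)) ⨯₃ vecPart (linkM L v v' g e))| +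
        |⟪covCurl (1 : GaugeConfig 3 L SU2) (linkEmbed L v), covCurlLin c (linkEmbed L v)⟫| + |⟪covCurl (1 : GaugeConfig 3 L SU2) (linkEmbed L v'), covCurlLin c (linkEmbed L v')⟫| :=
        abs_add_three _ _ _
    _ ≤ 12 * ∑ e : Edge 3 L, ‖c e.2‖ * ‖vecPart (g (e.1.shift e.2))‖ * ‖vecPart (linkM L v v' g e)‖ + 40 * α * N * (‖linkEmbed L v‖ ^ 2 + ‖linkEmbed L v'‖ ^ 2) := by
        nlinarith [hkin, hmv, hmv']

/-! ## §4 ★★ The linear part rotates with the slow datum and averages to zero -/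

/-- `diagX1` at the conjugated slow datum is `diagX1` at the rotated colour vectors. [folklore] -/
theorem diagX1_slowLin_conj (β : ℝ) (d : SU2) (u : GaugeConfig 3 1 SU2) (v v' : Edge 3 L → Fin 3 → ℝ) (g : Site 3 L → SU2) :
    diagX1 L β (slowLin (gaugeTransform (fun _ : Site 3 1 => d) u)) v v' g = diagX1 L β (fun k => (adRot d).mulVec (slowLin u k)) v v' g := by
  have hc : slowLin (gaugeTransform (fun _ : Site 3 1 => d) u) = fun k => (adRot d).mulVec (slowLin u k) := funext fun k => slowLin_conj d u k
  rw [hc]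

/-- ★★ **`∫_d diagX1(slowLin (dud⁻¹)) dd = 0`**: the first-order diagonal slow dependence of the Laplace phase averages out under the colour rotation of `u`. [cite: Luscher1983, §3] -/
theorem integral_diagX1_conj_eq_zero (β : ℝ) (u : GaugeConfig 3 1 SU2) (v v' : Edge 3 L → Fin 3 → ℝ) (g : Site 3 L → SU2) :
    ∫ d, diagX1 L β (slowLin (gaugeTransform (fun _ : Site 3 1 => d) u)) v v' g ∂haarProbability SU2 = 0 := by
  simp_rw [diagX1_slowLin_conj]
  -- `diagX1 β · v v' g` is a linear functional of the colour vectors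
  set Φ : (Fin 3 → Fin 3 → ℝ) →ₗ[ℝ] ℝ :=
    { toFun := fun c => diagX1 L β c v v' g
      map_add' := fun c c' => by
        unfold diagX1
        rw [covCurlLin_add_left, covCurlLin_add_left, inner_add_right, inner_add_right]
        simp only [Pi.add_apply, add_dotProduct, Finset.sum_add_distrib]
        ring
      map_smul' := fun t c => by
        unfold diagX1
        rw [covCurlLin_smul_left, covCurlLin_smul_left, inner_smul_right, inner_smul_right]
        simp only [Pi.smul_apply, smul_dotProduct, smul_eq_mul, RingHom.id_apply, ← Finset.mul_sum]
        ring } with hΦ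
  exact integral_linear_adRot_eq_zero Φ (slowLin u)

end Summit.QuantumFields.YangMills.Theorems.FemtoTransferGap.TwoLattice.ConstTube

end
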